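import Summits.AnomalousDissipation.AnomalousDissipation.Theorems.SolenoidalFractalHomogenisationLagrangianStepSidebandDefsFrame
import Summits.AnomalousDissipation.AnomalousDissipation.Theorems.SolenoidalFractalHomogenisationLagrangianStepSidebandSkew
import Summits.AnomalousDissipation.AnomalousDissipation.Theorems.SolenoidalFractalHomogenisationLagrangianStepCellChainModesFrame
import HarnessLib

/-!
# K1L_D `LagrangianRenormalisationStepDesign` (stmt-AnomalousDissipation-27980), registered stub `stub_D1_V0thg` (v28, rulings D28-3 (3)/D28-6/D28-7), port-map layer L4:
# DISSIPATIVITY OF THE TWISTED (frozen-frame `G₀`) AUGMENTED TRUNCATED SIDEBAND GENERATOR and the skew identity of the shear links with twisted projections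
# (helper; `--kind proof --supports stmt-AnomalousDissipation-27980 --as helper`)

Summits-side helper file of route `SolenoidalFractalHomogenisation` (prover seat `ad-k1l-cellLawV-w1` g9; road of record D28-7 = port map
`Cruxes/LagrangianRenormalisationStepDesign/Lines/onelevel-vtheta-twist-portmap.md` §3 L4).  Everything proved; no definitions, no named facts, no sorry.
The frozen-frame twin of `…SidebandSkew` (brick T3) for the objects of `…SidebandDefsFrame` (`genCompθ`, `genθ`; `P^θ_w = transversalProjR (twistFreq G₀ w)`,
symbol of `Visc4.conj G₀ 𝔸`); the slot-data lemmas of the flat file (`ne_zero_of_mem_box`, `real_inner_space_eq_sum`, `linkCoeff_sub_self`, `linkCoeff_re`,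
`re_conj_linkCoeff_mul_real`) are REUSED BY NAME.
* `re_inner_sub_transversalProjR` (`Re⟪y − P^θ y, y⟫ = ‖y‖² − ‖P^θ y‖²`), `transversalProjR_coordL_eq_sum`;
* `re_inner_transversalProjR_symbT_ge` — twisted transversal coercivity `lo'·c·‖P^θ_k y‖² ≤ Re⟪P^θ_k T_{(𝔸^{G₀})ᵀ}(k) P^θ_k y, y⟫` for `k ≠ 0`, `NearIso 𝔸 lo' hi'`
  (UNDEFORMED tensor) and a frame constant `c |k|² ≤ |G₀ᵀk|²` (from `sq_one_sub_mul_freqNormSq_le_sum_twistFreq_sq`: `c = (1 − 3θ)²` for `|G₀ − 1| ≤ θ ≤ 1/3`);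
* **`sum_re_inner_link_eq_zero_frame`** — THE SKEW IDENTITY with twisted projections (only self-adjointness of `P^θ` and the ladder structure are used);
* `genCompθ_apply`, `re_inner_genCompθ`;
* **`real_inner_genθ_le`** — `⟪genθ W₁ 𝔸 G₀ γ₁ R t y, y⟫_ℝ ≤ −min(γ₁, 4π²·lo'·c)·‖y‖²` for ALL `y ∈ Space R`: the hypothesis `hA₂₂` of G7
  `…CellLawVSlowGraphLinearResponse.linearGraph_periodic_on` for the twisted truncated ξ = 0 sideband system, uniformly in `R`, `t` (⇒ existence and
  uniqueness of `Sideband.responseθ`, next file).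
NOT a proof of `stub_D1_V0thg`, of K1L_D, or of anomalous dissipation; rung F-D1.A0 infrastructure.
-/

set_option linter.dupNamespace false

noncomputable section

namespace Summit.AnomalousDissipation.AnomalousDissipation.Theorems.SolenoidalFractalHomogenisation.LagrangianStep.Sideband

open Set MeasureTheory Complex UnitAddTorus
open scoped InnerProductSpace
open Literature.Analysis Literature.Analysis.FunctionSpaces Literature.Analysis.FunctionSpaces.Torus
open Literature.Analysis.FluidPDE Literature.Analysis.FluidPDE.Torus Literature.Analysis.FluidPDE.LatticeShear
open Summit.AnomalousDissipation.AnomalousDissipation.Theorems.SolenoidalFractalHomogenisation.LagrangianStep.CellChain (linkCoeff)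

variable {k₀ : ℕ}

/-! ## Dissipativity of the twisted augmented truncated generator -/

section Skew

open Summit.AnomalousDissipation.AnomalousDissipation.Theorems.SolenoidalFractalHomogenisation.LagrangianStep.CellChain
  (rdot_transversalProjR' conj_linkCoeff linkCoeff_chain)

/-- `P^θ` is an orthogonal projection: `⟪P^θ w, y⟫ = ⟪P^θ w, P^θ y⟫`. [cite: Temam1984, Ch. III §1.1] -/
theorem inner_transversalProjR_eq_inner_transversalProjR (G₀ : Matrix (Fin 3) (Fin 3) ℝ) (k : Fin 3 → ℤ) (w y : EuclideanSpace ℂ (Fin 3)) :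
    ⟪transversalProjR (twistFreq G₀ k) w, y⟫_ℂ = ⟪transversalProjR (twistFreq G₀ k) w, transversalProjR (twistFreq G₀ k) y⟫_ℂ :=
  (inner_transversalProjR_right_of_rdot_eq_zero _ (rdot_transversalProjR' _ w) y).symm

/-- `Re⟪y − P_k y, y⟫ = ‖y‖² − ‖P_k y‖²`. [cite: Temam1984, Ch. III §1.1] -/
theorem re_inner_sub_transversalProjR (G₀ : Matrix (Fin 3) (Fin 3) ℝ) (k : Fin 3 → ℤ) (y : EuclideanSpace ℂ (Fin 3)) :
    (⟪y - transversalProjR (twistFreq G₀ k) y, y⟫_ℂ).re = ‖y‖ ^ 2 - ‖transversalProjR (twistFreq G₀ k) y‖ ^ 2 := by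
  rw [inner_sub_left, inner_transversalProjR_eq_inner_transversalProjR G₀, inner_self_eq_norm_sq_to_K, inner_self_eq_norm_sq_to_K,
    Complex.sub_re]
  norm_cast

/-- **Twisted transversal coercivity of the projected conjugated symbol on a nonzero mode**: for `NearIso 𝔸 lo' hi'` (`lo' ≥ 0`, 𝔸 UNDEFORMED),
a frame with `c |k|² ≤ |G₀ᵀk|²` for all `k` (`0 ≤ c`) and `k ≠ 0`,
`lo'·c·‖P^θ_k y‖² ≤ Re⟪P^θ_k T_{(𝔸^{G₀})ᵀ}(k) P^θ_k y, y⟫` (`lo_mul_le_re_inner_symbT_conj` on the twisted plane, `|k|² ≥ 1`).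
[cite: Frisch1995Turbulence, §9.6.3 eq. (9.57) p. 233] [cite: ArmstrongVicol2025, §4.1 (PDF p. 34)] -/
theorem re_inner_transversalProjR_symbT_ge {𝔸 : Torus.Visc4 (Fin 3)} {lo' hi' : ℝ} (h𝔸 : Torus.NearIso 𝔸 lo' hi') (hlo' : 0 ≤ lo')
    (G₀ : Matrix (Fin 3) (Fin 3) ℝ) {c : ℝ} (hc0 : 0 ≤ c) (hG : ∀ k : Fin 3 → ℤ, c * freqNormSq k ≤ ∑ a, twistFreq G₀ k a ^ 2)
    {k : Fin 3 → ℤ} (hk : k ≠ 0) (y : EuclideanSpace ℂ (Fin 3)) :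
    lo' * c * ‖transversalProjR (twistFreq G₀ k) y‖ ^ 2 ≤
      (⟪transversalProjR (twistFreq G₀ k) (Torus.symbT (Torus.majorTranspose (Torus.Visc4.conj G₀ 𝔸)) k (transversalProjR (twistFreq G₀ k) y)),
        y⟫_ℂ).re := by
  have hT : Torus.NearIso (Torus.majorTranspose 𝔸) lo' hi' := (Torus.nearIso_majorTranspose_iff 𝔸 lo' hi').2 h𝔸
  have hkdot : rdot (twistFreq G₀ k) (transversalProjR (twistFreq G₀ k) y) = 0 := rdot_transversalProjR' _ y
  have h1 : (⟪transversalProjR (twistFreq G₀ k) (Torus.symbT (Torus.majorTranspose (Torus.Visc4.conj G₀ 𝔸)) k (transversalProjR (twistFreq G₀ k) y)),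
        y⟫_ℂ).re =
      (⟪transversalProjR (twistFreq G₀ k) y,
        Torus.symbT (Torus.Visc4.conj G₀ (Torus.majorTranspose 𝔸)) k (transversalProjR (twistFreq G₀ k) y)⟫_ℂ).re := by
    rw [inner_transversalProjR_comm, ← inner_conj_symm, Complex.conj_re, Torus.Visc4.conj_majorTranspose]
  rw [h1]
  have h2 := Torus.lo_mul_le_re_inner_symbT_conj hT G₀ hkdot
  have h3 : 1 ≤ freqNormSq k := Torus.one_le_freqNormSq_of_ne_zero hk
  have h4 : c ≤ ∑ a, twistFreq G₀ k a ^ 2 := (le_mul_of_one_le_right hc0 h3).trans (hG k)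
  have h5 : lo' * c * ‖transversalProjR (twistFreq G₀ k) y‖ ^ 2 ≤
      lo' * ((∑ a, twistFreq G₀ k a ^ 2) * ‖transversalProjR (twistFreq G₀ k) y‖ ^ 2) := by
    rw [mul_assoc]
    exact mul_le_mul_of_nonneg_left (mul_le_mul_of_nonneg_right h4 (sq_nonneg _)) hlo'
  exact h5.trans h2

/-- The projected amplitude read through `coordL` is a one-term sum over the box (support bookkeeping for the shift argument).
[cite: MajdaKramer1999, §2.2.1.3] -/
theorem transversalProjR_coordL_eq_sum (G₀ : Matrix (Fin 3) (Fin 3) ℝ) {R : ℕ} (w : Fin 3 → ℤ) (y : Space R) :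
    transversalProjR (twistFreq G₀ w) (coordL R w y) = ∑ z' : box R, if (z' : Fin 3 → ℤ) = w then transversalProjR (twistFreq G₀ z'.1) (y z') else 0 := by
  classical
  by_cases hw : w ∈ box R
  · rw [coordL_apply_of_mem hw, Finset.sum_eq_single (⟨w, hw⟩ : box R)]
    · simp
    · intro z' _ hz'
      have : (z' : Fin 3 → ℤ) ≠ w := fun h => hz' (Subtype.ext h)
      simp [this]
    · intro h; exact absurd (Finset.mem_univ _) h
  · rw [coordL_apply_of_not_mem hw, map_zero]
    symm
    refine Finset.sum_eq_zero fun z' _ => ?_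
    have : (z' : Fin 3 → ℤ) ≠ w := fun h => hw (h ▸ z'.2)
    simp [this]

/-- **The skew identity of the links on the truncated lattice**: for every slot `j` and every state `y`,
`Σ_{z∈box} Re⟪linkCoeffⱼ(z,t) • P_z(αⱼ P_{z−mⱼ} y_{z−mⱼ} + ᾱⱼ P_{z+mⱼ} y_{z+mⱼ}), y_z⟫ = 0` — the shear transport exchanges energy between
neighbours along the ladder and creates none (pairing `(z, z−mⱼ)`: the two cross terms are complex conjugate up to the purely imaginary common factor
`linkCoeffⱼ(z) = linkCoeffⱼ(z−mⱼ)`). [cite: MeshalkinSinai1961, pp. 1700–1705] [cite: MajdaKramer1999, §2.2.1.3] -/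
theorem sum_re_inner_link_eq_zero_frame (W₁ : LatticeWord k₀) (G₀ : Matrix (Fin 3) (Fin 3) ℝ) (R : ℕ) (j : Fin k₀) (t : ℝ) (y : Space R) :
    ∑ z : box R, (⟪linkCoeff W₁ 1 z.1 j t • transversalProjR (twistFreq G₀ z.1)
        (slotAmp W₁ j • transversalProjR (twistFreq G₀ (z.1 - (W₁.phase j).m)) (coordL R (z.1 - (W₁.phase j).m) y) +
          starRingEnd ℂ (slotAmp W₁ j) • transversalProjR (twistFreq G₀ (z.1 + (W₁.phase j).m)) (coordL R (z.1 + (W₁.phase j).m) y)), y z⟫_ℂ).re = 0 := by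
  classical
  -- opaque local names with defining equations (cheap for the elaborator)
  obtain ⟨m, hm⟩ : ∃ m : Fin 3 → ℤ, m = (W₁.phase j).m := ⟨_, rfl⟩
  obtain ⟨α, hα⟩ : ∃ α : ℂ, α = slotAmp W₁ j := ⟨_, rfl⟩
  obtain ⟨c, hc⟩ : ∃ c : (Fin 3 → ℤ) → ℂ, ∀ w, c w = linkCoeff W₁ 1 w j t := ⟨_, fun _ => rfl⟩
  obtain ⟨u, hu⟩ : ∃ u : box R → EuclideanSpace ℂ (Fin 3), ∀ z, u z = transversalProjR (twistFreq G₀ z.1) (y z) := ⟨_, fun _ => rfl⟩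
  obtain ⟨X, hX⟩ : ∃ X : box R → box R → ℂ, ∀ a b, X a b =
      if (b : Fin 3 → ℤ) = a.1 - m then starRingEnd ℂ (c a.1) * (starRingEnd ℂ α * ⟪u b, u a⟫_ℂ) else 0 := ⟨_, fun _ _ => rfl⟩
  obtain ⟨Y, hY⟩ : ∃ Y : box R → box R → ℂ, ∀ a b, Y a b =
      if (b : Fin 3 → ℤ) = a.1 + m then starRingEnd ℂ (c a.1) * (α * ⟪u b, u a⟫_ℂ) else 0 := ⟨_, fun _ _ => rfl⟩
  rw [← hm, ← hα]
  -- each summand splits into the two families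
  have key : ∀ z : box R, ⟪linkCoeff W₁ 1 z.1 j t • transversalProjR (twistFreq G₀ z.1)
        (α • transversalProjR (twistFreq G₀ (z.1 - m)) (coordL R (z.1 - m) y) + starRingEnd ℂ α • transversalProjR (twistFreq G₀ (z.1 + m)) (coordL R (z.1 + m) y)), y z⟫_ℂ
      = ∑ z', X z z' + ∑ z', Y z z' := by
    intro z
    rw [inner_smul_left, inner_transversalProjR_comm, ← hu z, ← hc z.1, inner_add_left, inner_smul_left, inner_smul_left,
      starRingEnd_self_apply, transversalProjR_coordL_eq_sum G₀, transversalProjR_coordL_eq_sum G₀, sum_inner, sum_inner]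
    have hA : ∑ z' : box R, ⟪(if (z' : Fin 3 → ℤ) = z.1 - m then transversalProjR (twistFreq G₀ z'.1) (y z') else 0), u z⟫_ℂ =
        ∑ z' : box R, (if (z' : Fin 3 → ℤ) = z.1 - m then ⟪u z', u z⟫_ℂ else 0) := by
      refine Finset.sum_congr rfl fun z' _ => ?_
      split_ifs
      · rw [hu z']
      · exact inner_zero_left _
    have hB : ∑ z' : box R, ⟪(if (z' : Fin 3 → ℤ) = z.1 + m then transversalProjR (twistFreq G₀ z'.1) (y z') else 0), u z⟫_ℂ =
        ∑ z' : box R, (if (z' : Fin 3 → ℤ) = z.1 + m then ⟪u z', u z⟫_ℂ else 0) := by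
      refine Finset.sum_congr rfl fun z' _ => ?_
      split_ifs
      · rw [hu z']
      · exact inner_zero_left _
    rw [hA, hB, mul_add, Finset.mul_sum, Finset.mul_sum, Finset.mul_sum, Finset.mul_sum]
    congr 1
    · refine Finset.sum_congr rfl fun z' _ => ?_
      rw [hX z z']
      simp only [mul_ite, mul_zero]
    · refine Finset.sum_congr rfl fun z' _ => ?_
      rw [hY z z']
      simp only [mul_ite, mul_zero]
  -- pair the terms: `X a b + Y b a` has zero real part
  have pair : ∀ a b : box R, (X a b + Y b a).re = 0 := by
    intro a b
    rw [hX a b, hY b a]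
    by_cases hab : (b : Fin 3 → ℤ) = a.1 - m
    · have hba : (a : Fin 3 → ℤ) = b.1 + m := by rw [hab]; abel
      rw [if_pos hab, if_pos hba]
      have hcb : c b.1 = c a.1 := by
        rw [hc, hc, hab, hm]; exact linkCoeff_sub_self W₁ a.1 j t
      rw [hcb, ← mul_add]
      have hw : starRingEnd ℂ α * ⟪u b, u a⟫_ℂ + α * ⟪u a, u b⟫_ℂ = ((2 * (α * ⟪u a, u b⟫_ℂ).re : ℝ) : ℂ) := by
        have h1 : starRingEnd ℂ α * ⟪u b, u a⟫_ℂ = starRingEnd ℂ (α * ⟪u a, u b⟫_ℂ) := by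
          rw [map_mul, inner_conj_symm]
        rw [h1, add_comm, Complex.add_conj]
      rw [hw, hc]
      exact re_conj_linkCoeff_mul_real W₁ 1 a.1 j t _
    · have hba : ¬ (a : Fin 3 → ℤ) = b.1 + m := fun h => hab (by rw [h]; abel)
      rw [if_neg hab, if_neg hba, add_zero, Complex.zero_re]
  -- assemble
  calc ∑ z : box R, (⟪linkCoeff W₁ 1 z.1 j t • transversalProjR (twistFreq G₀ z.1)
        (α • transversalProjR (twistFreq G₀ (z.1 - m)) (coordL R (z.1 - m) y) + starRingEnd ℂ α • transversalProjR (twistFreq G₀ (z.1 + m)) (coordL R (z.1 + m) y)), y z⟫_ℂ).re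
      = ∑ a : box R, ((∑ b, X a b) + ∑ b, Y a b).re := Finset.sum_congr rfl fun z _ => by rw [key z]
    _ = ∑ a : box R, ∑ b : box R, (X a b).re + ∑ a : box R, ∑ b : box R, (Y a b).re := by
        simp only [Complex.add_re, Complex.re_sum, Finset.sum_add_distrib]
    _ = ∑ a : box R, ∑ b : box R, (X a b).re + ∑ b : box R, ∑ a : box R, (Y a b).re := by
        rw [Finset.sum_comm (f := fun a b => (Y a b).re)]
    _ = ∑ a : box R, ∑ b : box R, ((X a b).re + (Y b a).re) := by
        rw [← Finset.sum_add_distrib]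
        refine Finset.sum_congr rfl fun a _ => ?_
        rw [← Finset.sum_add_distrib]
    _ = 0 := Finset.sum_eq_zero fun a _ => Finset.sum_eq_zero fun b _ => by rw [← Complex.add_re, pair a b]

/-- **Components of the augmented generator, applied** (with the own amplitude read through `coordL`; on the box `coordL R z y = y z`,
`coordL_apply_of_mem`). [cite: MajdaKramer1999, §2.2.1.3 (cell problem (49))] -/
theorem genCompθ_apply (W₁ : LatticeWord k₀) (𝔸 : Torus.Visc4 (Fin 3)) (G₀ : Matrix (Fin 3) (Fin 3) ℝ) (γ₁ : ℝ) (R : ℕ) (t : ℝ) (z : box R) (y : Space R) :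
    genCompθ W₁ 𝔸 G₀ γ₁ R t z y =
      -((((4 * Real.pi ^ 2 : ℝ) : ℂ)) • transversalProjR (twistFreq G₀ z.1) (Torus.symbT (Torus.majorTranspose (Torus.Visc4.conj G₀ 𝔸)) z.1 (transversalProjR (twistFreq G₀ z.1) (coordL R z.1 y)))) -
      ((γ₁ : ℝ) : ℂ) • (coordL R z.1 y - transversalProjR (twistFreq G₀ z.1) (coordL R z.1 y)) -
      ∑ j, linkCoeff W₁ 1 z.1 j t • transversalProjR (twistFreq G₀ z.1)
        (slotAmp W₁ j • transversalProjR (twistFreq G₀ (z.1 - (W₁.phase j).m)) (coordL R (z.1 - (W₁.phase j).m) y) +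
          starRingEnd ℂ (slotAmp W₁ j) • transversalProjR (twistFreq G₀ (z.1 + (W₁.phase j).m)) (coordL R (z.1 + (W₁.phase j).m) y)) := by
  have hsum : (∑ j, linkCoeff W₁ 1 z.1 j t • ((transversalProjR (twistFreq G₀ z.1)).comp
      (slotAmp W₁ j • ((transversalProjR (twistFreq G₀ (z.1 - (W₁.phase j).m))).comp (coordL R (z.1 - (W₁.phase j).m))) +
        starRingEnd ℂ (slotAmp W₁ j) • ((transversalProjR (twistFreq G₀ (z.1 + (W₁.phase j).m))).comp (coordL R (z.1 + (W₁.phase j).m)))))) y =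
      ∑ j, linkCoeff W₁ 1 z.1 j t • transversalProjR (twistFreq G₀ z.1)
        (slotAmp W₁ j • transversalProjR (twistFreq G₀ (z.1 - (W₁.phase j).m)) (coordL R (z.1 - (W₁.phase j).m) y) +
          starRingEnd ℂ (slotAmp W₁ j) • transversalProjR (twistFreq G₀ (z.1 + (W₁.phase j).m)) (coordL R (z.1 + (W₁.phase j).m) y)) := by
    rw [sum_apply]
    refine Finset.sum_congr rfl fun j _ => ?_
    rw [smul_apply, ContinuousLinearMap.comp_apply, add_apply, smul_apply, smul_apply, ContinuousLinearMap.comp_apply,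
      ContinuousLinearMap.comp_apply]
  rw [genCompθ, sub_apply, sub_apply, neg_apply, smul_apply, smul_apply, hsum, ContinuousLinearMap.comp_apply,
    ContinuousLinearMap.comp_apply, ContinuousLinearMap.comp_apply, symbTL_apply, sub_apply, ContinuousLinearMap.comp_apply]

/-- **The fibre balance of the augmented generator**: for `z ∈ box`,
`Re⟪(gen y)_z, y_z⟫ = −4π²·Re⟪P T_{𝔸ᵀ} P y_z, y_z⟫ − γ₁(‖y_z‖² − ‖P y_z‖²) − Re⟪Σⱼ linkⱼ, y_z⟫`. [cite: MajdaKramer1999, §2.2.1.3] -/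
theorem re_inner_genCompθ (W₁ : LatticeWord k₀) (𝔸 : Torus.Visc4 (Fin 3)) (G₀ : Matrix (Fin 3) (Fin 3) ℝ) (γ₁ : ℝ) (R : ℕ) (t : ℝ) (z : box R) (y : Space R) :
    (⟪genCompθ W₁ 𝔸 G₀ γ₁ R t z y, y z⟫_ℂ).re =
      -(4 * Real.pi ^ 2 * (⟪transversalProjR (twistFreq G₀ z.1) (Torus.symbT (Torus.majorTranspose (Torus.Visc4.conj G₀ 𝔸)) z.1 (transversalProjR (twistFreq G₀ z.1) (y z))), y z⟫_ℂ).re) -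
      γ₁ * (‖y z‖ ^ 2 - ‖transversalProjR (twistFreq G₀ z.1) (y z)‖ ^ 2) -
      ∑ j, (⟪linkCoeff W₁ 1 z.1 j t • transversalProjR (twistFreq G₀ z.1)
        (slotAmp W₁ j • transversalProjR (twistFreq G₀ (z.1 - (W₁.phase j).m)) (coordL R (z.1 - (W₁.phase j).m) y) +
          starRingEnd ℂ (slotAmp W₁ j) • transversalProjR (twistFreq G₀ (z.1 + (W₁.phase j).m)) (coordL R (z.1 + (W₁.phase j).m) y)), y z⟫_ℂ).re := by
  rw [genCompθ_apply, coordL_apply_of_mem z.2, inner_sub_left, inner_sub_left, inner_neg_left, inner_smul_left, inner_smul_left, sum_inner,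
    Complex.sub_re, Complex.sub_re, Complex.neg_re, Complex.conj_ofReal, Complex.conj_ofReal, Complex.re_ofReal_mul,
    Complex.re_ofReal_mul, re_inner_sub_transversalProjR G₀, Complex.re_sum]

/-- **DISSIPATIVITY OF THE AUGMENTED TRUNCATED FAST GENERATOR** (the hypothesis `hA₂₂` of G7 `…SlowGraphLinearResponse.linearGraph_periodic_on`):
for `NearIso 𝔸 lo' hi'` with `lo' ≥ 0`, every `γ₁` (meant `≥ 0`), every truncation `R`, time `t` and state `y`,
`⟪genθ W₁ 𝔸 G₀ γ₁ R t y, y⟫_ℝ ≤ −min(γ₁, 4π²·lo'·c)·‖y‖²` for a frame with `c|k|² ≤ |G₀ᵀk|²` — twisted-transversal parts are damped by the conjugated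
symbol (`|G₀ᵀz|² ≥ c|z|² ≥ c`), twisted-longitudinal parts by `γ₁`, and the links create no energy (`sum_re_inner_link_eq_zero_frame`). [cite: MajdaKramer1999, §2.2.1.3] [cite: SandersVerhulstMurdock2007, Lemma 5.2.7 (linear case)] -/
theorem real_inner_genθ_le (W₁ : LatticeWord k₀) {𝔸 : Torus.Visc4 (Fin 3)} {lo' hi' : ℝ} (h𝔸 : Torus.NearIso 𝔸 lo' hi') (hlo' : 0 ≤ lo')
    (G₀ : Matrix (Fin 3) (Fin 3) ℝ) {c : ℝ} (hc0 : 0 ≤ c) (hG : ∀ k : Fin 3 → ℤ, c * freqNormSq k ≤ ∑ a, twistFreq G₀ k a ^ 2)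
    (γ₁ : ℝ) (R : ℕ) (t : ℝ) (y : Space R) :
    ⟪genθ W₁ 𝔸 G₀ γ₁ R t y, y⟫_ℝ ≤ -(min γ₁ (4 * Real.pi ^ 2 * (lo' * c))) * ‖y‖ ^ 2 := by
  classical
  rw [real_inner_space_eq_sum, PiLp.norm_sq_eq_of_L2]
  have hterm : ∀ z : box R, (⟪genθ W₁ 𝔸 G₀ γ₁ R t y z, y z⟫_ℂ).re =
      -(4 * Real.pi ^ 2 * (⟪transversalProjR (twistFreq G₀ z.1) (Torus.symbT (Torus.majorTranspose (Torus.Visc4.conj G₀ 𝔸)) z.1 (transversalProjR (twistFreq G₀ z.1) (y z))), y z⟫_ℂ).re) -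
      γ₁ * (‖y z‖ ^ 2 - ‖transversalProjR (twistFreq G₀ z.1) (y z)‖ ^ 2) -
      ∑ j, (⟪linkCoeff W₁ 1 z.1 j t • transversalProjR (twistFreq G₀ z.1)
        (slotAmp W₁ j • transversalProjR (twistFreq G₀ (z.1 - (W₁.phase j).m)) (coordL R (z.1 - (W₁.phase j).m) y) +
          starRingEnd ℂ (slotAmp W₁ j) • transversalProjR (twistFreq G₀ (z.1 + (W₁.phase j).m)) (coordL R (z.1 + (W₁.phase j).m) y)), y z⟫_ℂ).re := by
    intro z; rw [genθ_apply, re_inner_genCompθ]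
  rw [Finset.sum_congr rfl fun z _ => hterm z, Finset.sum_sub_distrib, Finset.sum_comm, Finset.sum_eq_zero
    (fun j _ => sum_re_inner_link_eq_zero_frame W₁ G₀ R j t y), sub_zero, Finset.mul_sum]
  refine Finset.sum_le_sum fun z _ => ?_
  have hz0 : (z : Fin 3 → ℤ) ≠ 0 := ne_zero_of_mem_box z.2
  have h1 := re_inner_transversalProjR_symbT_ge h𝔸 hlo' G₀ hc0 hG hz0 (y z)
  have h2 : ‖transversalProjR (twistFreq G₀ z.1) (y z)‖ ^ 2 ≤ ‖y z‖ ^ 2 :=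
    pow_le_pow_left₀ (norm_nonneg _) (norm_transversalProjR_le _ (y z)) 2
  have hμ1 : min γ₁ (4 * Real.pi ^ 2 * (lo' * c)) ≤ γ₁ := min_le_left _ _
  have hμ2 : min γ₁ (4 * Real.pi ^ 2 * (lo' * c)) ≤ 4 * Real.pi ^ 2 * (lo' * c) := min_le_right _ _
  have hlc : 0 ≤ lo' * c := mul_nonneg hlo' hc0
  have ha : 0 ≤ ‖transversalProjR (twistFreq G₀ z.1) (y z)‖ ^ 2 := sq_nonneg _
  nlinarith [h1, h2, hμ1, hμ2, ha, hlc, sub_nonneg.2 h2, Real.pi_pos, mul_nonneg hlc ha]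

end Skew

end Summit.AnomalousDissipation.AnomalousDissipation.Theorems.SolenoidalFractalHomogenisation.LagrangianStep.Sideband

end
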